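import Summits.NavierStokesRegularity.NavierStokesRegularity.Theorems.IntenseSetDoorsDefs
import HarnessLib

/-!
# IntenseSetDoorsMassPower — door family S34 «IntenseSetDoors», plate A34-C «CriticalMassPowerBoundAssembly»
# PROVED: the critical-mass stretching estimate (T34C) and the forced power-weighted slab inequality (G34) give the
# sub-Leray power bound `∫|∇u(t)|²_F ≤ K (T − t)^{−a}`, `a = (2/√3)ε₀ < 1/2` (P1-C `CriticalMassPowerBound`)

S-door lane (LEAD ns-s30-p1 g2, plate map 2026-08-28T14:21:00Z key (4); planner of record nsreg-p1 g28, ROUND-32 /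
`r32/Sketch34.lean` c542dddc314f2f7c = tree P0 `Theorems/IntenseSetDoorsDefs.lean`), seat ns-s29-p2 g4,
`--supports stmt-NavierStokesRegularity-0056 --as helper`.  BY NAME against P0: the hypotheses are the Prop NAMES
`CriticalMassStretching` (T34C) and `ForcedPowerGronwallSlab` (G34); nothing is restated.

Proof (the glue of the sketch's §5; no new idea; bookkeeping copied from the A33 file `…CriticalCoherenceDoorPower`
of nsreg-C26-p1 g5): `ε₂ := 1/(C+1)` with the absolute `C` of T34C; at `t₀ = 0` (`criticalMassPowerBound_zero`),
for `t < T` work on the closed slab `[0, (t+T)/2]`: at each slab time `s` apply T34C with `L := ε₀/(T − s)` (so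
`{L < |ω|} = {ε₀ < (T − s)|ω|}`), bound `(2/√3)L∫|∇u|²_F ≤ (a/(T − s))∫|ω|²` by the `div`–`curl` inequality
`lintegral_frobeniusNormSq_fderiv_le_lintegral_sq_norm_curl` (`a = (2/√3)ε₀`) and
`C(∫_{S}|ω|^{3/2})^{2/3}∫|∇ω|²_F ≤ Cε₂ν∫|∇ω|²_F ≤ ν∫|∇ω|²_F` by `CriticalMass`; then G34 with `β = 0`, `c = 0`
gives `∫|ω(t)|² ≤ (∫|ω(0)|²)T^a(T − t)^{−a}`, uniformly in the slab; finally `∫|∇u|²_F ≤ ∫|ω|²` again.  General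
`t₀`: translate time (`IsClassicalNSSolutionOn.translate_Ico_zero`; `CriticalMass` translates because
`T − t = (T − t₀) − (t − t₀)`).

WHAT THIS IS NOT: S34-C is a regularity CRITERION (light scale-critical intense set ⇒ continuation) about
HYPOTHETICAL blow-up; item 0056 `NoTypeII` and NS regularity are NOT proved; no Literature fact is taken as a
hypothesis; nothing here is a route or a summit statement.
-/

noncomputable section

open MeasureTheory Set Function Filter Metric Real InnerProductSpace
open _root_.Topology
open scoped ENNReal NNReal RealInnerProductSpace ContDiff
open Literature.Analysis.FluidPDE
open Summit.NavierStokesRegularity.NavierStokesRegularity.Theorems.CriticalCoherenceDoor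

set_option linter.dupNamespace false

namespace Summit.NavierStokesRegularity.NavierStokesRegularity.Theorems.IntenseSetDoors

-- nested operator types (second derivatives)
set_option maxSynthPendingDepth 3

/-- the exponent of door C: `a := (2/√3)ε₀ ∈ [0, 1/2)` for `0 < ε₀ < √3/4`. [folklore] -/
theorem massExponent_lt_half {ε₀ : ℝ} (hε₀ : 0 < ε₀) (hε₁ : ε₀ < Real.sqrt 3 / 4) :
    0 ≤ 2 / Real.sqrt 3 * ε₀ ∧ 2 / Real.sqrt 3 * ε₀ < 1 / 2 := by
  have h3 : 0 < Real.sqrt 3 := Real.sqrt_pos.2 (by norm_num)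
  refine ⟨by positivity, ?_⟩
  rw [div_mul_eq_mul_div, div_lt_iff₀ h3]
  linarith

/-- `ofReal` of a (possibly non-integrable) set integral of a non-negative function is dominated by the
set lower integral. [folklore] -/
theorem integral_le_of_setLIntegral_le {X : Type*} [MeasurableSpace X] {μ : Measure X} {S : Set X}
    {f : X → ℝ} (hf : ∀ x, 0 ≤ f x) {B : ℝ} (hB : 0 ≤ B)
    (h : ∫⁻ x in S, ENNReal.ofReal (f x) ∂μ ≤ ENNReal.ofReal B) : ∫ x in S, f x ∂μ ≤ B := by
  by_cases hi : Integrable f (μ.restrict S)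
  · have e := ofReal_integral_eq_lintegral_ofReal hi (Eventually.of_forall fun x => hf x)
    exact (ENNReal.ofReal_le_ofReal_iff hB).1 (e ▸ h)
  · rw [integral_undef hi]; exact hB

set_option maxHeartbeats 800000 in
/-- **A34-C at `t₀ = 0`.** If `CriticalMassStretching` and `ForcedPowerGronwallSlab` hold, there is an absolute
`ε₂ > 0` such that: for `ν > 0`, `T > 0`, `0 < ε₀ < √3/4`, a classical unforced Navier–Stokes solution `(u, p)`
on `ℝ³ × [0, T)` with all `L²` Sobolev seminorms bounded on every `[0, T'']`, `T'' < T`, and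
`CriticalMass u ν T 0 ε₀ ε₂`, the Dirichlet integral obeys `∫|∇u(t)|²_F ≤ K (T − t)^{−a}` on `[0, T)` with
`K = (∫|ω(0)|²)T^a ≥ 0`, `a = (2/√3)ε₀ < 1/2`. [folklore] -/
theorem criticalMassPowerBound_zero (hT : CriticalMassStretching) (hG : ForcedPowerGronwallSlab) :
    ∃ ε₂ : ℝ, 0 < ε₂ ∧ ∀ (ν T ε₀ : ℝ), 0 < ν → 0 < T → 0 < ε₀ → ε₀ < Real.sqrt 3 / 4 →
      ∀ (u : ℝ → (EuclideanSpace ℝ (Fin 3)) → (EuclideanSpace ℝ (Fin 3)))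
        (p : ℝ → (EuclideanSpace ℝ (Fin 3)) → ℝ),
        IsClassicalNSSolutionOn (Ico 0 T) ν 0 u p →
        (∀ T'' < T, HasBoundedSobolevNormsOn (Icc 0 T'') u) →
        CriticalMass u ν T 0 ε₀ ε₂ →
        ∃ K a : ℝ, 0 ≤ K ∧ a < 1 / 2 ∧ ∀ t ∈ Ico 0 T,
          (∫⁻ x, ENNReal.ofReal (frobeniusNormSq (fderiv ℝ (u t) x))) ≤
            ENNReal.ofReal (K * (T - t) ^ (-a)) := by
  obtain ⟨C, hC0, hstr⟩ := hT
  set ε₂ : ℝ := 1 / (C + 1) with hε₂def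
  have hε₂ : 0 < ε₂ := by positivity
  refine ⟨ε₂, hε₂, ?_⟩
  intro ν T ε₀ hν hTpos hε₀ hε₁ u p hsol hreg hmass
  obtain ⟨ha0, ha⟩ := massExponent_lt_half hε₀ hε₁
  set a : ℝ := 2 / Real.sqrt 3 * ε₀ with hadef
  set Y₀ : ℝ := ∫ x, ‖curl (u 0) x‖ ^ 2 with hY₀
  have hY₀0 : 0 ≤ Y₀ := integral_nonneg fun x => sq_nonneg _
  have hTa : 0 ≤ T ^ a := Real.rpow_nonneg hTpos.le _
  refine ⟨Y₀ * T ^ a, a, mul_nonneg hY₀0 hTa, ha, ?_⟩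
  intro t ht
  have hTt : 0 < T - t := by linarith [ht.2]
  -- a closed slab containing `t`
  set T'' : ℝ := (t + T) / 2 with hT''def
  have htT'' : t < T'' := by rw [hT''def]; linarith [ht.2]
  have hT''T : T'' < T := by rw [hT''def]; linarith [ht.2]
  have hT''pos : 0 < T'' := lt_of_le_of_lt ht.1 htT''
  have hS : IsClassicalNSSolutionOn (Icc 0 T'') ν 0 u p :=
    hsol.mono (Icc_subset_Ico_right hT''T) (uniqueDiffOn_Icc hT''pos)
  have hB : HasBoundedSobolevNormsOn (Icc 0 T'') u := hreg T'' hT''T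
  have htS : t ∈ Icc 0 T'' := ⟨ht.1, htT''.le⟩
  -- finite energy on the slab (Sobolev bound of order 0)
  have hen : ∀ s ∈ Icc 0 T'', ∫⁻ x, ‖u s x‖ₑ ^ 2 < ⊤ := by
    obtain ⟨C0, hC0⟩ := hB 0
    intro s hs
    refine lt_of_le_of_lt (le_of_eq (lintegral_congr fun x => ?_)) ((hC0 s hs).trans_lt ENNReal.coe_lt_top)
    rw [← ofReal_norm, ← ofReal_norm, norm_iteratedFDeriv_zero]
  -- the stretching estimate on the slab in the form G34 wants (`β = 0`, `c = 0`)
  have hstrS : ∀ s ∈ Icc 0 T'',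
      2 * ∫ x, ⟪curl (u s) x, fderiv ℝ (u s) x (curl (u s) x)⟫ ≤
        ν * (∫ x, frobeniusNormSq (fderiv ℝ (curl (u s)) x)) +
          a / (T - s) * (∫ x, ‖curl (u s) x‖ ^ 2) + 0 * (T - s) ^ (-(0 : ℝ)) := by
    intro s hs
    have hsT : s ∈ Ico 0 T := ⟨hs.1, hs.2.trans_lt hT''T⟩
    have hTs : 0 < T - s := by linarith [hsT.2]
    have hL : 0 < ε₀ / (T - s) := div_pos hε₀ hTs
    have hv : ContDiff ℝ ∞ (u s) := hS.contDiff_velocity hs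
    have hv4 : ContDiff ℝ 4 (u s) := hv.of_le (by norm_cast)
    have hv3 : ContDiff ℝ 3 (u s) := hv.of_le (by norm_cast)
    have hv2 : ContDiff ℝ 2 (u s) := hv.of_le (by norm_cast)
    have hfin : ∀ n, ∫⁻ x, ‖iteratedFDeriv ℝ n (u s) x‖ₑ ^ 2 < ⊤ := fun n => by
      obtain ⟨Cn, hCn⟩ := hB n
      exact (hCn s hs).trans_lt ENNReal.coe_lt_top
    have i0 : Integrable fun x => ‖u s x‖ ^ 2 :=
      integrable_sq_norm_of_lintegral_lt_top hv.continuous (hen s hs)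
    have i1 : Integrable fun x => ‖fderiv ℝ (u s) x‖ ^ 2 := by
      have h := integrable_sq_norm_of_lintegral_lt_top
        (hv4.continuous_iteratedFDeriv (by norm_num)) (hfin 1)
      exact h.congr (Eventually.of_forall fun x => by simp only [norm_iteratedFDeriv_one])
    have i2 : Integrable fun x => ‖fderiv ℝ (fderiv ℝ (u s)) x‖ ^ 2 := by
      have h := integrable_sq_norm_of_lintegral_lt_top
        (hv4.continuous_iteratedFDeriv (by norm_num)) (hfin 2)
      refine h.congr (Eventually.of_forall fun x => ?_)
      show ‖iteratedFDeriv ℝ 2 (u s) x‖ ^ 2 = ‖fderiv ℝ (fderiv ℝ (u s)) x‖ ^ 2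
      rw [← norm_iteratedFDeriv_fderiv, norm_iteratedFDeriv_one]
    obtain ⟨B₂, -, hB₂⟩ := exists_forall_norm_fderiv_fderiv_le_of_hasBoundedSobolevNormsOn
      (fun r hr => (hS.contDiff_velocity hr).of_le (by norm_cast)) hB
    have h := hstr (ε₀ / (T - s)) hL hv3 (hS.divFree s hs) i0 i1 i2 ⟨B₂, hB₂ s hs⟩
    -- the pieces
    set F : ℝ := ∫ x, frobeniusNormSq (fderiv ℝ (u s) x) with hFdef
    set Y : ℝ := ∫ x, ‖curl (u s) x‖ ^ 2 with hYdef
    set D : ℝ := ∫ x, frobeniusNormSq (fderiv ℝ (curl (u s)) x) with hDdef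
    set M : ℝ := ∫ x in {x | ε₀ / (T - s) < ‖curl (u s) x‖}, ‖curl (u s) x‖ ^ (3 / 2 : ℝ) with hMdef
    have hD0 : 0 ≤ D := integral_nonneg fun x => frobeniusNormSq_nonneg _
    have hM0 : 0 ≤ M := integral_nonneg fun x => Real.rpow_nonneg (norm_nonneg _) _
    have hY0 : 0 ≤ Y := integral_nonneg fun x => sq_nonneg _
    -- the critical mass: `M ≤ (ε₂ν)^{3/2}`, so `C M^{2/3} ≤ C ε₂ ν ≤ ν`
    have hSet : {x | ε₀ / (T - s) < ‖curl (u s) x‖} = {x | ε₀ < (T - s) * ‖curl (u s) x‖} := by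
      ext x
      simp only [mem_setOf_eq]
      rw [div_lt_iff₀ hTs, mul_comm]
    have hε₂ν : 0 ≤ ε₂ * ν := by positivity
    have hMle : M ≤ (ε₂ * ν) ^ (3 / 2 : ℝ) := by
      have hm := hmass s hsT
      rw [← hSet] at hm
      exact integral_le_of_setLIntegral_le (fun x => Real.rpow_nonneg (norm_nonneg _) _)
        (Real.rpow_nonneg hε₂ν _) hm
    have hM23 : M ^ (2 / 3 : ℝ) ≤ ε₂ * ν := by
      calc M ^ (2 / 3 : ℝ) ≤ ((ε₂ * ν) ^ (3 / 2 : ℝ)) ^ (2 / 3 : ℝ) :=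
            Real.rpow_le_rpow hM0 hMle (by norm_num)
        _ = ε₂ * ν := by
            rw [← Real.rpow_mul hε₂ν]
            norm_num
    have hCε : C * (ε₂ * ν) ≤ ν := by
      have hC1 : 0 < C + 1 := by linarith
      have hq : C / (C + 1) ≤ 1 := (div_le_one hC1).2 (by linarith)
      calc C * (ε₂ * ν) = C / (C + 1) * ν := by rw [hε₂def]; ring
        _ ≤ 1 * ν := mul_le_mul_of_nonneg_right hq hν.le
        _ = ν := one_mul ν
    have hhigh : C * M ^ (2 / 3 : ℝ) * D ≤ ν * D :=
      mul_le_mul_of_nonneg_right ((mul_le_mul_of_nonneg_left hM23 hC0).trans hCε) hD0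
    -- the `div`–`curl` inequality `F ≤ Y`
    have hFY : F ≤ Y := by
      have hl := lintegral_frobeniusNormSq_fderiv_le_lintegral_sq_norm_curl hv2 (hS.divFree s hs)
        (hen s hs)
      have hcurl_int : Integrable fun x => ‖curl (u s) x‖ ^ 2 := by
        refine integrable_sq_norm_of_lintegral_lt_top (continuous_curl (hv.of_le (by norm_cast))) ?_
        exact lt_of_le_of_lt (lintegral_curl_sq_le (u s))
          (ENNReal.mul_lt_top ENNReal.ofReal_lt_top (hfin 1))
      have hYeq : (∫⁻ x, ‖curl (u s) x‖ₑ ^ 2) = ENNReal.ofReal Y := by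
        rw [show (∫⁻ x, ‖curl (u s) x‖ₑ ^ 2) = ∫⁻ x, ENNReal.ofReal (‖curl (u s) x‖ ^ 2) from
          lintegral_congr fun x => by rw [← ofReal_norm, ENNReal.ofReal_pow (norm_nonneg _)],
          ← ofReal_integral_eq_lintegral_ofReal hcurl_int (Eventually.of_forall fun x => sq_nonneg _)]
      rw [hYeq] at hl
      by_cases hi : Integrable fun x => frobeniusNormSq (fderiv ℝ (u s) x)
      · rw [← ofReal_integral_eq_lintegral_ofReal hi
          (Eventually.of_forall fun x => frobeniusNormSq_nonneg _)] at hl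
        exact (ENNReal.ofReal_le_ofReal_iff hY0).1 hl
      · rw [hFdef, integral_undef hi]
        exact hY0
    have hlow : 2 / Real.sqrt 3 * (ε₀ / (T - s)) * F ≤ a / (T - s) * Y := by
      have hcoef : 2 / Real.sqrt 3 * (ε₀ / (T - s)) = a / (T - s) := by rw [hadef]; ring
      rw [hcoef]
      exact mul_le_mul_of_nonneg_left hFY (div_nonneg ha0 hTs.le)
    rw [zero_mul, add_zero]
    linarith [h, hlow, hhigh]
  -- the forced power-weighted slab inequality with `β = 0`, `c = 0`
  have hY := hG ν T T'' a 0 0 hν hT''pos hT''T ha0 le_rfl (by linarith) u p hS hB hstrS t htS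
  have hKt : ∫ x, ‖curl (u t) x‖ ^ 2 ≤ Y₀ * T ^ a * (T - t) ^ (-a) := by
    refine hY.trans (le_of_eq ?_)
    rw [zero_mul, zero_div, add_zero]
  -- `∫|∇u|²_F ≤ ∫|ω|²`
  have hvt : ContDiff ℝ ∞ (u t) := hS.contDiff_velocity htS
  have hcurl_int : Integrable fun x => ‖curl (u t) x‖ ^ 2 := by
    have hfin1 : ∫⁻ x, ‖iteratedFDeriv ℝ 1 (u t) x‖ₑ ^ 2 < ⊤ := by
      obtain ⟨C1, hC1⟩ := hB 1
      exact (hC1 t htS).trans_lt ENNReal.coe_lt_top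
    refine integrable_sq_norm_of_lintegral_lt_top (continuous_curl (hvt.of_le (by norm_cast))) ?_
    exact lt_of_le_of_lt (lintegral_curl_sq_le (u t))
      (ENNReal.mul_lt_top ENNReal.ofReal_lt_top hfin1)
  refine (lintegral_frobeniusNormSq_fderiv_le_lintegral_sq_norm_curl
    (hvt.of_le (by norm_cast)) (hS.divFree t htS) (hen t htS)).trans ?_
  rw [show (∫⁻ x, ‖curl (u t) x‖ₑ ^ 2) = ∫⁻ x, ENNReal.ofReal (‖curl (u t) x‖ ^ 2) from
    lintegral_congr fun x => by rw [← ofReal_norm, ENNReal.ofReal_pow (norm_nonneg _)],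
    ← ofReal_integral_eq_lintegral_ofReal hcurl_int (Eventually.of_forall fun x => sq_nonneg _)]
  exact ENNReal.ofReal_le_ofReal hKt

/-- **Plate A34-C «CriticalMassPowerBoundAssembly» PROVED**: `CriticalMassStretching → ForcedPowerGronwallSlab →
CriticalMassPowerBound` (the Prop names of `Theorems/IntenseSetDoorsDefs.lean`). Proof: translate time by `t₀`
(`IsClassicalNSSolutionOn.translate_Ico_zero`; the Sobolev bounds and `CriticalMass` translate, the latter
because `T − t = (T − t₀) − (t − t₀)`), apply `criticalMassPowerBound_zero` on `[0, T − t₀)`, translate back.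
[folklore] -/
theorem criticalMassPowerBoundAssembly_holds : CriticalMassPowerBoundAssembly := by
  intro hT hG
  obtain ⟨ε₂, hε₂, h0⟩ := criticalMassPowerBound_zero hT hG
  refine ⟨ε₂, hε₂, ?_⟩
  intro ν T t₀ ε₀ hν ht₀ ht₀T hε₀ hε₁ u p hsol hreg hmass
  have hTt : 0 < T - t₀ := by linarith
  -- the translate
  have hsol' : IsClassicalNSSolutionOn (Ico 0 (T - t₀)) ν 0 (fun t => u (t + t₀))
      (fun t => p (t + t₀)) := hsol.translate_Ico_zero ht₀
  have hreg' : ∀ T'' < T - t₀, HasBoundedSobolevNormsOn (Icc 0 T'') (fun t => u (t + t₀)) := by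
    intro T'' hT'' n
    obtain ⟨C, hC⟩ := hreg (T'' + t₀) (by linarith) n
    exact ⟨C, fun t ht => hC (t + t₀) ⟨by linarith [ht.1], by linarith [ht.2]⟩⟩
  have hmass' : CriticalMass (fun t => u (t + t₀)) ν (T - t₀) 0 ε₀ ε₂ := by
    intro t ht
    have h := hmass (t + t₀) ⟨by linarith [ht.1], by linarith [ht.2]⟩
    have hTT : T - (t + t₀) = T - t₀ - t := by ring
    rw [hTT] at h
    exact h
  obtain ⟨K, a, hK0, ha, hF⟩ := h0 ν (T - t₀) ε₀ hν hTt hε₀ hε₁ _ _ hsol' hreg' hmass'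
  refine ⟨K, a, hK0, ha, fun t ht => ?_⟩
  have h := hF (t - t₀) ⟨by linarith [ht.1], by linarith [ht.2]⟩
  have hTT : T - t₀ - (t - t₀) = T - t := by ring
  simp only [sub_add_cancel, hTT] at h
  exact h

end Summit.NavierStokesRegularity.NavierStokesRegularity.Theorems.IntenseSetDoors

end
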